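import Summits.MatrixMultiplication.OmegaCensus.SmallFormats.InvertiblePointFrame
import HarnessLib

/-!
# ω-census family (a): the `d`-DEFECT FOOTPRINT LAW at an arbitrary invertible point of `⟨m,m,n⟩`

Cell `pub-omega` (unit `pub-omega-tensor-g27`), topic `Summits/MatrixMultiplication/OmegaCensus` (sub-folder `SmallFormats`).
Framing (verbatim): lottery ticket; floor = certified bounds/negative ranges. HONEST FRAMING: elementary structural identities over an
arbitrary field, unifying `InvertiblePointFrame` (p434823: the saturated case, `d = 0`) and `InvertiblePointNearFrame` (p493611: the
near case, `d = 1`) at an invertible point with ANY number `d` of extra non-vanishing terms — the situation of the last orbit of the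
`𝔽₃` `⟨2,2,5⟩ @ 17` X-marginal census that neither machinery reaches (orbit 60420: `|O| = 2n + 2` at 22 invertible classes,
tensor g27 `HANDOFF.md`). Not a rank bound; nothing on `ω`.

**Setting (point moved to `X₀ = 1`).** `β` computes `X ↦ XY` (`X ∈ k^{m×m}`, `Y ∈ k^{m×n}`); `O ⊇ {i : f_i(1) ≠ 0}` with
`f_i(1) ≠ 0` on `O`; `γ_s := f_s(1)·g_s`, `c_s := f_s/f_s(1)`. Let `D ⊆ O` (the `d` 'removed' terms) and let `(W'_j)_{j ∈ O∖D}`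
be a DUAL FAMILY for the functionals `(γ_s)_{s∈O∖D}`: `γ_s(W'_j) = δ_{sj}` (it exists, and is a basis of `k^{m×n}`, exactly when
these `m·n` functionals are a basis of the dual space — the generic choice of `D` at a point with `|O| = m·n + d`).
* (`defectBasis_eq`) `W_j = W'_j − Σ_{k∈D} γ_k(W'_j)·W_k` (Brent at `X = 1`);
* (`defectBasis_footprint_eq`) for `j ∈ O∖D` and every `X`:
  `X·W'_j − c_j(X)·W'_j = Σ_{k∈D} (c_k(X) − c_j(X))·γ_k(W'_j)·W_k + Σ_{t∉O} f_t(X) g_t(W'_j)·W_t`;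
* (`defectBasis_footprint_mem`) hence `X·W'_j − c_j(X)·W'_j ∈ span({W_k : k ∈ D} ∪ {W_t : t ∉ O})`, a space of dimension
  `≤ |Z| + d = r − m·n` WHATEVER `d` is — so the footprint filter of the saturated case (Kronecker types of `(r − m·n)`-dimensional
  target spaces, `B_p` spaces, Rado) applies verbatim to the off multiset minus the `d` classes of `D`, for every admissible `D`;
* (`defect_transport`) on `K₀ := ⋂_{t∉O} ker g_t`: `X·W = Σ_{j∈O∖D} c_j(X) γ_j(W)·W'_j + Σ_{k∈D} Λ_k(X, W)·W_k` with the `d` defect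
  coefficients `Λ_k(X, W) := c_k(X) γ_k(W) − Σ_{j∈O∖D} c_j(X) γ_j(W) γ_k(W'_j)` — the `d`-defect form of the frame transport
  `γ_j(XW) = c_j(X) γ_j(W)` of the saturated case.
No orbit data, no search. (`d = 1`: with `D = {j₀}` and `W'_j = W_j − (σ_j/σ_{j₀}) W_{j₀}` these are `nearBasis_footprint_eq` /
`mul_eq_nearBrent` of p493611, whose `γ_{j₀}(W'_j) = −σ_j/σ_{j₀}`.)
-/

namespace Summit.MatrixMultiplication.OmegaCensus.SmallFormats

open Module Matrix Literature.Computability.AlgebraicComplexity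

variable {k : Type*} [Field k] {m n : ℕ} {ι : Type*} [Fintype ι] [DecidableEq ι]

section Defect

variable (β : BilinComp (mulBilin k m m n) ι) (O D : Finset ι)

/-- **Brent at `X = 1` on a dual family.** If `γ_s(W'_j) = δ_{sj}` for `s, j ∈ O ∖ D` (`γ_s = f_s(1) g_s`), then
`W'_j = W_j + Σ_{k∈D} γ_k(W'_j) W_k`, i.e. `W_j = W'_j − Σ_{k∈D} γ_k(W'_j) W_k`. -/
theorem defectBasis_eq (hO : ∀ i, i ∉ O → β.f i 1 = 0) (hD : D ⊆ O) (W' : ι → Matrix (Fin m) (Fin n) k)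
    (hdual : ∀ s ∈ O \ D, ∀ j ∈ O \ D, β.f s 1 * β.g s (W' j) = if s = j then 1 else 0) {j : ι} (hj : j ∈ O \ D) :
    β.w j = W' j - ∑ l ∈ D, (β.f l 1 * β.g l (W' j)) • β.w l := by
  have h := mul_eq_sum_off β 1 O hO (W' j)
  rw [Matrix.one_mul, ← Finset.sum_sdiff hD] at h
  have h1 : ∑ s ∈ O \ D, (β.f s 1 * β.g s (W' j)) • β.w s = β.w j := by
    rw [Finset.sum_congr rfl fun s hs => by rw [hdual s hs j hj]]
    simp only [ite_smul, one_smul, zero_smul, Finset.sum_ite_eq', if_pos hj]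
  rw [h1] at h
  exact eq_sub_of_add_eq h.symm

/-- **The `d`-defect footprint law.** For a dual family `W'` of `(γ_s)_{s∈O∖D}` and `j ∈ O ∖ D`, every `X`:
`X·W'_j − c_j(X)·W'_j = Σ_{k∈D} (c_k(X) − c_j(X))·γ_k(W'_j)·W_k + Σ_{t∉O} f_t(X) g_t(W'_j)·W_t`
(`c_s(X) = f_s(X)/f_s(1)`). -/
theorem defectBasis_footprint_eq (hO : ∀ i, i ∉ O → β.f i 1 = 0) (hO' : ∀ i ∈ O, β.f i 1 ≠ 0) (hD : D ⊆ O)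
    (W' : ι → Matrix (Fin m) (Fin n) k)
    (hdual : ∀ s ∈ O \ D, ∀ j ∈ O \ D, β.f s 1 * β.g s (W' j) = if s = j then 1 else 0) {j : ι} (hj : j ∈ O \ D)
    (X : Matrix (Fin m) (Fin m) k) :
    X * W' j - (β.f j X * (β.f j 1)⁻¹) • W' j =
      ∑ l ∈ D, ((β.f l X * (β.f l 1)⁻¹ - β.f j X * (β.f j 1)⁻¹) * (β.f l 1 * β.g l (W' j))) • β.w l +
        ∑ t ∈ Finset.univ \ O, (β.f t X * β.g t (W' j)) • β.w t := by
  classical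
  have hjO : j ∈ O := (Finset.mem_sdiff.mp hj).1
  -- Brent at `(X, W'_j)`, split over `O ∖ D`, `D`, `Oᶜ`
  have hB := β.map_eq_sum X (W' j)
  rw [mulBilin_apply] at hB
  have hsplit : ∑ i, (β.f i X * β.g i (W' j)) • β.w i =
      ∑ s ∈ O \ D, (β.f s X * β.g s (W' j)) • β.w s + ∑ l ∈ D, (β.f l X * β.g l (W' j)) • β.w l +
        ∑ t ∈ Finset.univ \ O, (β.f t X * β.g t (W' j)) • β.w t := by
    rw [← Finset.sum_sdiff (Finset.subset_univ O), ← Finset.sum_sdiff hD]; abel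
  -- the `O ∖ D` part is `c_j(X) · W_j`
  have hOD : ∑ s ∈ O \ D, (β.f s X * β.g s (W' j)) • β.w s = (β.f j X * (β.f j 1)⁻¹) • β.w j := by
    have : ∀ s ∈ O \ D, (β.f s X * β.g s (W' j)) • β.w s =
        (if s = j then (β.f j X * (β.f j 1)⁻¹) • β.w j else 0) := by
      intro s hs
      have hs1 : β.f s 1 ≠ 0 := hO' s (Finset.mem_sdiff.mp hs).1
      have hd := hdual s hs j hj
      have hg : β.g s (W' j) = (β.f s 1)⁻¹ * (if s = j then 1 else 0) := by
        rw [← hd]; field_simp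
      rw [hg]
      split_ifs with hsj
      · subst hsj; congr 1; ring
      · rw [mul_zero, mul_zero, zero_smul]
    rw [Finset.sum_congr rfl this, Finset.sum_ite_eq' (O \ D) j, if_pos hj]
  -- the `D` part: `f_l(X) g_l(W'_j) = c_l(X) γ_l(W'_j)`
  have hDp : ∑ l ∈ D, (β.f l X * β.g l (W' j)) • β.w l =
      ∑ l ∈ D, ((β.f l X * (β.f l 1)⁻¹) * (β.f l 1 * β.g l (W' j))) • β.w l := by
    refine Finset.sum_congr rfl fun l hl => ?_
    have hl1 : β.f l 1 ≠ 0 := hO' l (hD hl)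
    congr 1; field_simp
  rw [hsplit, hOD, hDp] at hB
  -- substitute `W_j = W'_j − Σ_{l∈D} γ_l(W'_j) W_l`
  rw [defectBasis_eq β O D hO hD W' hdual hj, smul_sub, Finset.smul_sum] at hB
  rw [hB]
  simp only [sub_mul, sub_smul, Finset.sum_sub_distrib, smul_smul]
  abel

/-- **Membership form.** `X·W'_j − c_j(X)·W'_j ∈ span({W_k : k ∈ D} ∪ {W_t : t ∉ O})` — a target space of dimension at most
`|D| + |Oᶜ| = r − |O ∖ D|`, i.e. `r − m·n` for a dual BASIS, independently of the defect `d = |D|`. -/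
theorem defectBasis_footprint_mem (hO : ∀ i, i ∉ O → β.f i 1 = 0) (hO' : ∀ i ∈ O, β.f i 1 ≠ 0) (hD : D ⊆ O)
    (W' : ι → Matrix (Fin m) (Fin n) k)
    (hdual : ∀ s ∈ O \ D, ∀ j ∈ O \ D, β.f s 1 * β.g s (W' j) = if s = j then 1 else 0) {j : ι} (hj : j ∈ O \ D)
    (X : Matrix (Fin m) (Fin m) k) :
    X * W' j - (β.f j X * (β.f j 1)⁻¹) • W' j ∈
      Submodule.span k (β.w '' (↑D ∪ (↑(Finset.univ \ O) : Set ι))) := by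
  rw [defectBasis_footprint_eq β O D hO hO' hD W' hdual hj X]
  refine Submodule.add_mem _ (Submodule.sum_mem _ fun l hl => Submodule.smul_mem _ _ ?_)
    (Submodule.sum_mem _ fun t ht => Submodule.smul_mem _ _ ?_)
  · exact Submodule.subset_span ⟨l, Or.inl hl, rfl⟩
  · exact Submodule.subset_span ⟨t, Or.inr ht, rfl⟩

/-- **`d`-defect transport on `K₀`.** If `W` is killed by every `g_t`, `t ∉ O`, then in the dual family
`X·W = Σ_{j∈O∖D} c_j(X) γ_j(W)·W'_j + Σ_{k∈D} Λ_k(X,W)·W_k` with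
`Λ_k(X, W) = c_k(X) γ_k(W) − Σ_{j∈O∖D} c_j(X) γ_j(W) γ_k(W'_j)`. -/
theorem defect_transport (hO : ∀ i, i ∉ O → β.f i 1 = 0) (hO' : ∀ i ∈ O, β.f i 1 ≠ 0) (hD : D ⊆ O)
    (W' : ι → Matrix (Fin m) (Fin n) k)
    (hdual : ∀ s ∈ O \ D, ∀ j ∈ O \ D, β.f s 1 * β.g s (W' j) = if s = j then 1 else 0)
    {W : Matrix (Fin m) (Fin n) k} (hW : ∀ t, t ∉ O → β.g t W = 0) (X : Matrix (Fin m) (Fin m) k) :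
    X * W = ∑ j ∈ O \ D, ((β.f j X * (β.f j 1)⁻¹) * (β.f j 1 * β.g j W)) • W' j +
      ∑ l ∈ D, ((β.f l X * (β.f l 1)⁻¹) * (β.f l 1 * β.g l W) -
        ∑ j ∈ O \ D, (β.f j X * (β.f j 1)⁻¹) * (β.f j 1 * β.g j W) * (β.f l 1 * β.g l (W' j))) • β.w l := by
  classical
  -- Brent without the `Z`-terms
  have hXW : X * W = ∑ s ∈ O, (β.f s X * β.g s W) • β.w s := by
    have hB := β.map_eq_sum X W
    rw [mulBilin_apply] at hB
    rw [hB, ← Finset.sum_subset (Finset.subset_univ O)]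
    intro s _ hs; rw [hW s hs, mul_zero, zero_smul]
  rw [hXW, ← Finset.sum_sdiff hD]
  -- rewrite `f_s(X) g_s(W) = c_s(X) γ_s(W)` on `O`
  have hc : ∀ s ∈ O, β.f s X * β.g s W = (β.f s X * (β.f s 1)⁻¹) * (β.f s 1 * β.g s W) := by
    intro s hs; have := hO' s hs; field_simp
  have hsum1 : ∑ s ∈ O \ D, (β.f s X * β.g s W) • β.w s =
      ∑ s ∈ O \ D, ((β.f s X * (β.f s 1)⁻¹) * (β.f s 1 * β.g s W)) • β.w s :=
    Finset.sum_congr rfl fun s hs => by rw [hc s (Finset.mem_sdiff.mp hs).1]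
  have hsum2 : ∑ l ∈ D, (β.f l X * β.g l W) • β.w l =
      ∑ l ∈ D, ((β.f l X * (β.f l 1)⁻¹) * (β.f l 1 * β.g l W)) • β.w l :=
    Finset.sum_congr rfl fun l hl => by rw [hc l (hD hl)]
  -- substitute `W_s = W'_s − Σ_l γ_l(W'_s) W_l` on `O ∖ D`
  have hsub : ∑ s ∈ O \ D, ((β.f s X * (β.f s 1)⁻¹) * (β.f s 1 * β.g s W)) • β.w s =
      ∑ s ∈ O \ D, ((β.f s X * (β.f s 1)⁻¹) * (β.f s 1 * β.g s W)) • W' s -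
        ∑ l ∈ D, (∑ s ∈ O \ D, (β.f s X * (β.f s 1)⁻¹) * (β.f s 1 * β.g s W) * (β.f l 1 * β.g l (W' s))) • β.w l := by
    have step : ∀ s ∈ O \ D, ((β.f s X * (β.f s 1)⁻¹) * (β.f s 1 * β.g s W)) • β.w s =
        ((β.f s X * (β.f s 1)⁻¹) * (β.f s 1 * β.g s W)) • W' s -
          ∑ l ∈ D, ((β.f s X * (β.f s 1)⁻¹) * (β.f s 1 * β.g s W) * (β.f l 1 * β.g l (W' s))) • β.w l := by
      intro s hs
      rw [defectBasis_eq β O D hO hD W' hdual hs, smul_sub, Finset.smul_sum]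
      simp only [smul_smul]
    rw [Finset.sum_congr rfl step, Finset.sum_sub_distrib, Finset.sum_comm]
    simp only [← Finset.sum_smul]
  rw [hsum1, hsum2, hsub]
  simp only [sub_smul, Finset.sum_sub_distrib]
  abel

end Defect

end Summit.MatrixMultiplication.OmegaCensus.SmallFormats
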